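import Mathlib.Combinatorics.SimpleGraph.Walk.Basic
import Mathlib.Combinatorics.SimpleGraph.Paths
import HarnessLib

/-!
# Sub-walks between a `P`-vertex and a `Q`-vertex (first visits, last visits)

Topic `Literature/Combinatorics/SimpleGraph`. Two elementary decompositions of walks of a simple
graph used by first-exit / last-entrance arguments on lattice paths (e.g. Grimmett, *Percolation*
(1999), §7.4, "the first exit from `B(R-1)` of the path"; Dembin 2020, Lemma 4.1, the crossing of a
face cylinder between the last visit to one side and the first visit to the other):

* `exists_subwalk_forall_imp_eq_end` — a walk ending at a `Q`-vertex has an initial sub-walk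
  ending at a `Q`-vertex which is its only `Q`-vertex (first visit);
* `exists_subwalk_between` — a walk from a `P`-vertex to a `Q`-vertex contains a sub-walk from a
  `P`-vertex `a` to a `Q`-vertex `b` on which `a` is the only `P`-vertex and `b` the only
  `Q`-vertex.

Sub-walks are given with the inclusions of their edge and support lists.

## References

* G. Grimmett, *Percolation*, 2nd ed., Springer 1999, §7.4 p. 186 [GrimmettPercolation1999].
* B. Dembin, ALEA 17 (2020), Lemma 4.1 [Dembin2020].
-/

namespace Literature.Combinatorics.SimpleGraph

variable {X : Type*} {H : _root_.SimpleGraph X}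

/-- **First visit.** A walk ending at a `Q`-vertex has an initial sub-walk (same start) ending at
a `Q`-vertex `b` which is its only `Q`-vertex. [folklore] -/
theorem exists_subwalk_forall_imp_eq_end (Q : X → Prop) :
    ∀ {x y : X} (w : H.Walk x y), Q y →
      ∃ (b : X) (q : H.Walk x b), Q b ∧ (∀ e ∈ q.edges, e ∈ w.edges) ∧
        (∀ z ∈ q.support, z ∈ w.support) ∧ ∀ z ∈ q.support, Q z → z = b
  | x, _, .nil, hy =>
    ⟨x, .nil, hy, fun _ he => he, fun _ hz => hz, fun z hz _ => by simpa using hz⟩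
  | x, _, .cons (v := v) hadj w, hy => by
    classical
    by_cases hx : Q x
    · refine ⟨x, .nil, hx, fun e he => by simp at he, fun z hz => ?_, fun z hz _ => by simpa using hz⟩
      rw [_root_.SimpleGraph.Walk.support_nil, List.mem_singleton] at hz
      subst hz
      exact _root_.SimpleGraph.Walk.start_mem_support _
    · obtain ⟨b, q, hb, hqe, hqs, hq⟩ := exists_subwalk_forall_imp_eq_end Q w hy
      refine ⟨b, .cons hadj q, hb, fun e he => ?_, fun z hz => ?_, fun z hz hQz => ?_⟩
      · rw [_root_.SimpleGraph.Walk.edges_cons, List.mem_cons] at he ⊢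
        rcases he with rfl | he
        · exact Or.inl rfl
        · exact Or.inr (hqe e he)
      · rw [_root_.SimpleGraph.Walk.support_cons, List.mem_cons] at hz ⊢
        rcases hz with rfl | hz
        · exact Or.inl rfl
        · exact Or.inr (hqs z hz)
      · rw [_root_.SimpleGraph.Walk.support_cons, List.mem_cons] at hz
        rcases hz with rfl | hz
        · exact absurd hQz hx
        · exact hq z hz hQz

/-- **Sub-walk between a `P`-vertex and a `Q`-vertex.** A walk from a `P`-vertex to a `Q`-vertex
contains a sub-walk from a `P`-vertex `a` to a `Q`-vertex `b` on which `a` is the only `P`-vertex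
and `b` the only `Q`-vertex (the last visit to `P` before the first visit to `Q`). [folklore] -/
theorem exists_subwalk_between (P Q : X → Prop) {x y : X} (w : H.Walk x y) (hx : P x) (hy : Q y) :
    ∃ (a b : X) (q : H.Walk a b), P a ∧ Q b ∧ (∀ e ∈ q.edges, e ∈ w.edges) ∧
      (∀ z ∈ q.support, z ∈ w.support) ∧ (∀ z ∈ q.support, P z → z = a) ∧
      ∀ z ∈ q.support, Q z → z = b := by
  obtain ⟨b, q₁, hb, hq₁e, hq₁s, hq₁⟩ := exists_subwalk_forall_imp_eq_end Q w hy
  obtain ⟨a, q₂, ha, hq₂e, hq₂s, hq₂⟩ := exists_subwalk_forall_imp_eq_end P q₁.reverse hx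
  refine ⟨a, b, q₂.reverse, ha, hb, fun e he => ?_, fun z hz => ?_, fun z hz hPz => ?_,
    fun z hz hQz => ?_⟩
  · rw [_root_.SimpleGraph.Walk.edges_reverse, List.mem_reverse] at he
    have := hq₂e e he
    rw [_root_.SimpleGraph.Walk.edges_reverse, List.mem_reverse] at this
    exact hq₁e e this
  · rw [_root_.SimpleGraph.Walk.support_reverse, List.mem_reverse] at hz
    have := hq₂s z hz
    rw [_root_.SimpleGraph.Walk.support_reverse, List.mem_reverse] at this
    exact hq₁s z this
  · rw [_root_.SimpleGraph.Walk.support_reverse, List.mem_reverse] at hz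
    exact hq₂ z hz hPz
  · rw [_root_.SimpleGraph.Walk.support_reverse, List.mem_reverse] at hz
    have := hq₂s z hz
    rw [_root_.SimpleGraph.Walk.support_reverse, List.mem_reverse] at this
    exact hq₁ z this hQz

/-- **First visit, path form.** As `exists_subwalk_forall_imp_eq_end`, with the sub-walk a PATH
(no repeated vertices; pass to `bypass`), so that the `Q`-vertex `b` occurs only at the end.
[folklore] -/
theorem exists_path_forall_imp_eq_end [DecidableEq X] (Q : X → Prop) {x y : X} (w : H.Walk x y) (hy : Q y) :
    ∃ (b : X) (q : H.Walk x b), q.IsPath ∧ Q b ∧ (∀ e ∈ q.edges, e ∈ w.edges) ∧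
      (∀ z ∈ q.support, z ∈ w.support) ∧ ∀ z ∈ q.support, Q z → z = b := by
  obtain ⟨b, q, hb, hqe, hqs, hq⟩ := exists_subwalk_forall_imp_eq_end Q w hy
  refine ⟨b, q.bypass, q.bypass_isPath, hb, fun e he => hqe e (q.edges_bypass_subset_edges he),
    fun z hz => hqs z (q.support_bypass_subset_support hz), fun z hz hQz => hq z (q.support_bypass_subset_support hz) hQz⟩

/-- **The last step of a path into its endpoint.** A path from `x` to `b ≠ x` splits as a walk from
`x` to a neighbour `y'` of `b`, avoiding `b`, followed by the edge `y' b`. [folklore] -/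
theorem exists_walk_dropLast_of_isPath {x b : X} (q : H.Walk x b) (hq : q.IsPath) (hne : x ≠ b) :
    ∃ (y' : X) (r : H.Walk x y'), H.Adj y' b ∧ b ∉ r.support ∧
      (∀ e ∈ r.edges, e ∈ q.edges) ∧ (∀ z ∈ r.support, z ∈ q.support) ∧ s(y', b) ∈ q.edges := by
  obtain ⟨y', hadj, r', hr'⟩ := q.reverse.exists_eq_cons_of_ne (Ne.symm hne)
  have hpath : (_root_.SimpleGraph.Walk.cons hadj r').IsPath := by rw [← hr']; exact hq.reverse
  rw [_root_.SimpleGraph.Walk.cons_isPath_iff] at hpath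
  refine ⟨y', r'.reverse, hadj.symm, ?_, fun e he => ?_, fun z hz => ?_, ?_⟩
  · rw [_root_.SimpleGraph.Walk.support_reverse, List.mem_reverse]; exact hpath.2
  · rw [_root_.SimpleGraph.Walk.edges_reverse, List.mem_reverse] at he
    have : e ∈ q.reverse.edges := by rw [hr', _root_.SimpleGraph.Walk.edges_cons]; exact List.mem_cons_of_mem _ he
    rwa [_root_.SimpleGraph.Walk.edges_reverse, List.mem_reverse] at this
  · rw [_root_.SimpleGraph.Walk.support_reverse, List.mem_reverse] at hz
    have : z ∈ q.reverse.support := by rw [hr', _root_.SimpleGraph.Walk.support_cons]; exact List.mem_cons_of_mem _ hz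
    rwa [_root_.SimpleGraph.Walk.support_reverse, List.mem_reverse] at this
  · have : s(b, y') ∈ q.reverse.edges := by rw [hr', _root_.SimpleGraph.Walk.edges_cons]; exact List.mem_cons_self
    rw [_root_.SimpleGraph.Walk.edges_reverse, List.mem_reverse] at this
    rwa [Sym2.eq_swap]

end Literature.Combinatorics.SimpleGraph
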